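/-
Copyright (c) 2026 the pub-hodgecm-mathlib formalisation cell (harness21).  Prover seat hodgecm-mathlib-K2E1-p13 (g3), Track B ∕ K2-LIT, h413 = `stmt-HodgeConjecture-24833`,
line `K2_E1_TraceFormulaBeta`, route of record `HCCMUnconditional`; dealer K2E1-plan (g7) (254)∕(256): the (d)-realness road at M1 with the (conj) socket CLOSED — ★ p860445
`chi_scattering_conj_symm_m1_cm_two` fed by ★ K2E4-p14's scalar package (`K2E1ChiScatteringScalarPackageM1CMTwo`, tube formula at the singleton basis).
-/
import Summits.HodgeConjecture.HodgeConjecture.Theorems.K2E1ChiScatteringRealPolesM1CMTwoFinal     -- ★ p860692 (this seat): §1 trivia (`ne_zero_of_coeFn_ae_eq`), brings ★ p860653 `chi_scattering_hs_of_model_m1_cm_two`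
import Summits.HodgeConjecture.HodgeConjecture.Theorems.K2E1ChiScatteringScalarPackageM1CMTwo    -- ★ p860718 (K2E4-p14): `exists_scattering_scalar_package_selfDual_m1_cm_two` (package + tube formula)
import Summits.HodgeConjecture.HodgeConjecture.Theorems.K2E1ChiScatteringConjSymmetryM1CMTwo     -- ★ p860445 (this lineage, g2): `exists_galTwist_cm`, `chi_scattering_conj_symm_m1_cm_two`
import HarnessLib

/-!
# K2·E1 — `K2E1ChiScatteringRealPolesM1CMTwoLetterFree`: `hreal` AND `hs` FOR THE SCATTERING SCALAR `s = qc default` OF A SELF-DUAL UNITARY `χ` OF `U(1,1)_{L∕L⁺}` AT M1 WITH THE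
# REFLECTION SOCKET CLOSED — modulo `hdec` (constant-term decay) and the scalar (FE) only

Track B ∕ K2-LIT, crux h413 = `stmt-HodgeConjecture-24833`; cell `hodgecm-mathlib`, squad K2, ENGINE E1, campaign «5Res», (d)-block at M1 (consumer: K2E1-p14 (g2)'s (SD) M1 final assembly).
THEOREMS ONLY (no `def`, no `instance`, no notation, no named-fact hypothesis, no `sorry`; default heartbeats); lane `--kind proof --supports stmt-HodgeConjecture-24833 --as helper`
(count-neutral).  Closes no socket.

THE MATHEMATICS ([MoeglinWaldspurger1995, II.1.7, IV.1.10–IV.1.11, IV.3.12 (a)]; [Langlands1976, §7]; [BernsteinLapid2019, Thm 2.3, §4]).  At M1 the `χ`-block is RANK ONE: for a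
self-dual `χ` and a section `φ ∈ V(χ, K_max, 1)` with `φ(1) ≠ 0` the singleton `{φ}` is a basis of `V(χʷ, K_max, 1)` and the scattering operator is the SCALAR `s = qc default`, given on
the tube by `s(z) = (ν𝓕)⁻¹·φ(1)⁻¹·∫_N f_z^φ(w₀ v) dν` (★ K2E4-p14 `scatteringScalar_tube_of_coords` ∕ `exists_scattering_scalar_package_selfDual_m1_cm_two`).  With `φ(1)` REAL and `χ`
unitary, ★ p860445 `chi_scattering_conj_symm_m1_cm_two` (Galois twist ★ `exists_galTwist_cm`, Iwasawa, right-`K_max`-invariance ★ `apply_mul_of_mem`) gives the reflection symmetry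
`s(conj z) = conj s(z)` off `P ∪ conj P` — the (conj) socket of ★ `chi_scattering_real_poles_m1_final_cm_two` is CLOSED.  The `L²(K_U)`-class of `φ|_K` is non-zero (★ §1 of the M1
plug) and is its own one-element linearly independent family; `κ > 0` ★.  RESULT: §1 **`chi_scattering_hs_of_scalarPackage_m1_cm_two`** — hypothesis-first on the scalar package's
clauses at `ι′ := Unit`, `b := φ` (so it composes with ANY obtain of ★ §3) — and §2 **`chi_scattering_real_poles_m1_letterFree_cm_two`** — ★ §3's ∃-package VERBATIM **and** the bill
«`∀ σ₀ > 1`, (FE) → `hreal ∧ ∃ S U′, …`» for `s = qc default`, under the ONE outer socket `hdec` (payers: K2E4-p10 ARCH-CONST + K2E1-p12 `K2E1ChiMaassSelbergDecayLetterM1CMTwo`); the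
scalar (FE) socket is K2E1-p14's `K2E1ChiScatteringFunctionalEquationM1CMTwo`.
HONEST LABEL: HC_CM is proved only modulo the 7 printed citations (2 remaining named inputs: hLiu418 = `stmt-HodgeConjecture-24832`, h413 = `stmt-HodgeConjecture-24833`) until rung 0
closes; this file asserts no named fact, is conditional by construction on `hdec` and on the (FE) socket inside its conclusion, and closes no socket.

## References
* [MoeglinWaldspurger1995] C. Mœglin, J.-L. Waldspurger, *Spectral decomposition and Eisenstein series* (1995), II.1.7, IV.1.10–IV.1.11, IV.3.12 (a).
* [Langlands1976] R. P. Langlands, *On the Functional Equations Satisfied by Eisenstein Series*, LNM 544 (1976), §7.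
* [BernsteinLapid2019] J. Bernstein, E. Lapid, *On the meromorphic continuation of Eisenstein series*, J. AMS 37 (2024), Thm 2.3, §4.
-/

set_option autoImplicit false
set_option linter.dupNamespace false  -- the mandated namespace repeats the summit's segment (`HodgeConjecture.HodgeConjecture`)

noncomputable section

open MeasureTheory MeasureTheory.Measure Set NumberField IsDedekindDomain Filter Topology Metric
open scoped NNReal ENNReal ComplexConjugate InnerProductSpace
open Literature.MeasureTheory.Group Literature.NumberTheory
open Literature.NumberTheory.Automorphic Literature.NumberTheory.Automorphic.UnitaryGroup AdelicGroupData
open Literature.NumberTheory.GaloisRepresentations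
open Summit.HodgeConjecture.HodgeConjecture.Cruxes.H413.K2E1BorelEisensteinU
open Summit.HodgeConjecture.HodgeConjecture.Cruxes.H413.K2E1BLBorelSpacesU2Defs
open Summit.HodgeConjecture.HodgeConjecture.Cruxes.H413.K2E1BLBorelOperatorsU2Defs
open Summit.HodgeConjecture.HodgeConjecture.Cruxes.H413.K2E1CharacterEisensteinU2Defs
open Summit.HodgeConjecture.HodgeConjecture.Cruxes.H413.K2E1ChiSectionSpaceU2Defs
open Summit.HodgeConjecture.HodgeConjecture.Cruxes.H413.K2E1ChiScatteringRealPolesOfModelM1CMTwo (chi_scattering_hs_of_model_m1_cm_two)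
open Summit.HodgeConjecture.HodgeConjecture.Cruxes.H413.K2E1ChiScatteringRealPolesM1CMTwoFinal (ne_zero_of_coeFn_ae_eq)
open Summit.HodgeConjecture.HodgeConjecture.Cruxes.H413.K2E1ChiScatteringScalarPackageM1CMTwo (exists_scattering_scalar_package_selfDual_m1_cm_two)
open Summit.HodgeConjecture.HodgeConjecture.Cruxes.H413.K2E1ChiScatteringConjSymmetryM1CMTwo (exists_galTwist_cm chi_scattering_conj_symm_m1_cm_two)
open Summit.HodgeConjecture.HodgeConjecture.Cruxes.H413.K2E1MaassSelbergSphericalBracketsCMThree (idelicBracket_pos)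

namespace Summit.HodgeConjecture.HodgeConjecture.Cruxes.H413.K2E1ChiScatteringRealPolesM1CMTwoLetterFree

variable (L : Type) [Field L] [NumberField L] [IsCMField L]
variable [MeasurableSpace (quasiSplit (↥(maximalRealSubfield L)) L (IsCMField.complexConj L) 2).Adelic] [BorelSpace (quasiSplit (↥(maximalRealSubfield L)) L (IsCMField.complexConj L) 2).Adelic]
variable [MeasurableSpace (AdeleRing (𝓞 L) L)ˣ] [BorelSpace (AdeleRing (𝓞 L) L)ˣ]

/-! ## §1 Hypothesis-first on the scalar package's clauses (`ι′ := Unit`, `b := φ`): the (conj) socket closed by ★ p860445 -/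

/-- **`hreal ∧ hs` FOR `s = qc default` FROM THE SCALAR PACKAGE'S CLAUSES**, the reflection socket CLOSED: B1∕B2's structural data; `χ` self-dual unitary trivial on `ℝ_{>0}`; `φ ∈ V(χ, K_max, 1)`
continuous bounded with `φ(1) ≠ 0` REAL; the clauses of ★ `exists_scattering_scalar_package_selfDual_m1_cm_two` at the singleton basis `{φ}` (`hqφ`, `hqNF`, (E1), `hqcq`, `hPc hPcd hPre hqa`,
the per-ball families skolemised, the tube formula `hs_tube`); the socket `hdec` (all levels `T ≥ 1`) and the scalar (FE).  THEN `hreal` and the entry letter `hs` for `qc default` (★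
`chi_scattering_hs_of_model_m1_cm_two` with `V := L²(K_U)`, `bK := [φ|_K]`, and `hconj` := ★ `chi_scattering_conj_symm_m1_cm_two` on `hs_tube`).
[cite: MoeglinWaldspurger1995, IV.1.10–IV.1.11, IV.3.12 (a)] [cite: Langlands1976, §7] -/
theorem chi_scattering_hs_of_scalarPackage_m1_cm_two
    (μ : Measure (quasiSplit (↥(maximalRealSubfield L)) L (IsCMField.complexConj L) 2).automorphicQuotient) [(quasiSplit (↥(maximalRealSubfield L)) L (IsCMField.complexConj L) 2).IsAutomorphicMeasure μ]
    (νG : Measure (quasiSplit (↥(maximalRealSubfield L)) L (IsCMField.complexConj L) 2).Adelic) [νG.IsHaarMeasure] [νG.IsInvInvariant] [SFinite νG]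
    (μK : Measure ↥((standardMaximalCompactGL 2 L).comap (adelicVal (↥(maximalRealSubfield L)) L (IsCMField.complexConj L) 2 ((StdForm.antidiagonal 2).over L)) : Subgroup (quasiSplit (↥(maximalRealSubfield L)) L (IsCMField.complexConj L) 2).Adelic)) [μK.IsHaarMeasure]
    (νI : Measure (AdeleRing (𝓞 L) L)ˣ) [νI.IsHaarMeasure]
    {𝓕I : Set (AdeleRing (𝓞 L) L)ˣ} (h𝓕I : IsIdeleClassDomain L 𝓕I)
    (ν : Measure ↥(adelicUnipotent (↥(maximalRealSubfield L)) L (IsCMField.complexConj L) 2)) [ν.IsHaarMeasure] [ν.IsMulRightInvariant] [ν.IsInvInvariant]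
    {𝓕 : Set ↥(adelicUnipotent (↥(maximalRealSubfield L)) L (IsCMField.complexConj L) 2)} (h𝓕N : IsFundamentalDomain ↥(rationalUnipotent (↥(maximalRealSubfield L)) L (IsCMField.complexConj L) 2) 𝓕 ν) (h𝓕1 : ν 𝓕 = 1)
    (h𝓕c : IsCompact (closure 𝓕))
    {β : (quasiSplit (↥(maximalRealSubfield L)) L (IsCMField.complexConj L) 2).Adelic → ℝ≥0∞} (hβ : IsCoveringWeight ↥((arithmeticBorel (↥(maximalRealSubfield L)) L (IsCMField.complexConj L) 2).map (quasiSplit (↥(maximalRealSubfield L)) L (IsCMField.complexConj L) 2).arithmeticSubgroup.subtype) β)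
    -- the self-dual unitary character and the NORMALISED non-degenerate M1 section (`φ(1)` real, `≠ 0`)
    {χ : HeckeCharacter L} (hχ : χ.IsUnitary) (hρ : ∀ r : ℝ≥0ˣ, χ (posRealIdele L r) = 1) (hsd : reflectChar (IsCMField.complexConj L) χ = χ)
    {φ : (quasiSplit (↥(maximalRealSubfield L)) L (IsCMField.complexConj L) 2).Adelic → ℂ} (hφV : φ ∈ chiSectionSpace χ ((standardMaximalCompactGL 2 L).comap (adelicVal (↥(maximalRealSubfield L)) L (IsCMField.complexConj L) 2 ((StdForm.antidiagonal 2).over L)) : Subgroup (quasiSplit (↥(maximalRealSubfield L)) L (IsCMField.complexConj L) 2).Adelic) (fun _ => 1)) (hφc : Continuous φ) {Mφ : ℝ} (hφM : ∀ x, ‖φ x‖ ≤ Mφ)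
    (hφ1 : φ 1 ≠ 0) (hφ1r : conj (φ 1) = φ 1)
    -- the scalar package's clauses at the singleton basis (`b := φ`)
    {q qc : Unit → ℂ → ℂ} {Ec : ℂ → (quasiSplit (↥(maximalRealSubfield L)) L (IsCMField.complexConj L) 2).Adelic → ℂ} {P : Set ℂ}
    (hqφ : ∀ z : ℂ, 1 < z.re → (∑ j, q j z • φ) = ((((ν 𝓕).toReal⁻¹ : ℝ)) : ℂ) • (fun g : (quasiSplit (↥(maximalRealSubfield L)) L (IsCMField.complexConj L) 2).Adelic => (∫ v : ↥(adelicUnipotent (↥(maximalRealSubfield L)) L (IsCMField.complexConj L) 2), flatSectionU φ z ((quasiSplit (↥(maximalRealSubfield L)) L (IsCMField.complexConj L) 2).toAdelic (weylLongU ((IsCMField.complexConj L : L ≃ₐ[↥(maximalRealSubfield L)] L) : L →+* L) (rfl : (StdForm.antidiagonal 2).over L = (StdForm.antidiagonal 2).over L)) * ((v : (quasiSplit (↥(maximalRealSubfield L)) L (IsCMField.complexConj L) 2).Adelic) * g)) ∂ν) * (((borelHeight g : ℝ) : ℂ) ^ (z - 1))))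
    (hqNF : ∀ j, MeromorphicNFOn (qc j) univ) (hE1 : ∀ z : ℂ, 1 < z.re → Ec z = eisensteinSeriesU (flatSectionU φ z)) (hqcq : ∀ j (z : ℂ), 1 < z.re → qc j z = q j z)
    (hPc : IsClosed P) (hPcd : ∀ z₀ : ℂ, ∀ᶠ s in 𝓝[≠] z₀, s ∉ P) (hPre : ∀ z ∈ P, z.re ≤ 1) (hqa : ∀ j (z : ℂ), z ∉ P → AnalyticAt ℂ (qc j) z)
    (U : ℕ → Set ℂ) (hUo : ∀ n, IsOpen (U n)) (hUcod : ∀ n : ℕ, ∀ z₀ ∈ Metric.ball (0 : ℂ) (n + 2), ∀ᶠ s in 𝓝[≠] z₀, s ∈ U n)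
    (T₀ : ℕ → ℝ≥0) (hT₀ : ∀ n, 1 ≤ T₀ n) (Fam : ℕ → ℂ → Lp ℂ 2 μ) (hFd : ∀ n, DifferentiableOn ℂ (Fam n) (U n \ P))
    (hFam : ∀ n, ∀ z ∈ U n \ P, ((Fam n z : Lp ℂ 2 μ) : (quasiSplit (↥(maximalRealSubfield L)) L (IsCMField.complexConj L) 2).automorphicQuotient → ℂ) =ᵐ[μ] (quasiSplit (↥(maximalRealSubfield L)) L (IsCMField.complexConj L) 2).quotFun (truncation ν 𝓕 (T₀ n) (Ec z)))
    (hs_tube : ∀ z : ℂ, 1 < z.re → qc default z = (((ν 𝓕).toReal⁻¹ : ℝ) : ℂ) * ((φ 1)⁻¹ * ∫ v : ↥(adelicUnipotent (↥(maximalRealSubfield L)) L (IsCMField.complexConj L) 2), flatSectionU φ z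
        ((quasiSplit (↥(maximalRealSubfield L)) L (IsCMField.complexConj L) 2).toAdelic (weylLongU (IsCMField.complexConj L : L →+* L)
          (rfl : (StdForm.antidiagonal 2).over L = (StdForm.antidiagonal 2).over L)) * ((v : (quasiSplit (↥(maximalRealSubfield L)) L (IsCMField.complexConj L) 2).Adelic) * 1)) ∂ν))
    -- the sockets: constant-term decay above every level, and the scalar functional equation
    (hdec : ∀ T : ℝ≥0, 1 ≤ T → ∀ z' : ℂ, 1 < z'.re → ∃ M₁ : ℝ, ∀ g : (quasiSplit (↥(maximalRealSubfield L)) L (IsCMField.complexConj L) 2).Adelic, T < borelHeight g →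
      ‖eisensteinSeriesU (flatSectionU φ z') g - borelConstantTerm ν 𝓕 (eisensteinSeriesU (flatSectionU φ z')) g‖ ≤ M₁)
    (hFE : ∀ z : ℂ, z ∉ P → 1 - z ∉ P → qc default z * qc default (1 - z) = 1) {σ₀ : ℝ} (hσ₀ : 1 < σ₀) :
    (∀ z : ℂ, ¬ AnalyticAt ℂ (qc default) z → 1 / 2 < z.re → z.re ≤ σ₀ → z.im = 0 ∧ z.re < σ₀) ∧
      ∃ (S : Finset ℝ) (U' : Set ℂ), (∀ x ∈ S, ¬ AnalyticAt ℂ (qc default) (x : ℂ) ∧ 1 / 2 < x ∧ x < σ₀) ∧ IsOpen U' ∧ {z : ℂ | 1 / 2 ≤ z.re ∧ z.re ≤ σ₀} ⊆ U' ∧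
        DifferentiableOn ℂ (qc default) (U' \ ((S.image fun x : ℝ => (x : ℂ)) : Set ℂ)) := by
  classical
  -- (conj) for the scalar: ★ p860445 on the tube formula
  obtain ⟨cG, hcG⟩ := exists_galTwist_cm L
  have hφK : ∀ k : (quasiSplit (↥(maximalRealSubfield L)) L (IsCMField.complexConj L) 2).Adelic, adelicVal (↥(maximalRealSubfield L)) L (IsCMField.complexConj L) 2 _ k ∈ standardMaximalCompactGL 2 L → ∀ g, φ (g * k) = φ g :=
    fun k hk g => by
      have h := apply_mul_of_mem hφV g ⟨k, hk⟩
      simp only [one_mul] at h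
      exact h
  have hconj : ∀ z : ℂ, z ∉ P → conj z ∉ P → qc default (conj z) = conj (qc default z) :=
    chi_scattering_conj_symm_m1_cm_two L hcG ν ((ν 𝓕).toReal⁻¹) hsd hχ (isChiSection_of_mem hφV) hφK hφ1r hφ1r hPc hPcd hPre (hqa default) hs_tube
  have hconj' : ∀ j (z : ℂ), z ∉ P → conj z ∉ P → qc j (conj z) = conj (qc j z) := fun j => by
    obtain rfl : j = default := Subsingleton.elim _ _
    exact hconj
  have hFE' : ∀ j (z : ℂ), z ∉ P → 1 - z ∉ P → qc j z * qc j (1 - z) = 1 := fun j => by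
    obtain rfl : j = default := Subsingleton.elim _ _
    exact hFE
  -- the `L²(K_U)` class of `φ|_K`, non-zero, a one-element linearly independent family
  haveI : CompactSpace ↥((standardMaximalCompactGL 2 L).comap (adelicVal (↥(maximalRealSubfield L)) L (IsCMField.complexConj L) 2 ((StdForm.antidiagonal 2).over L)) : Subgroup (quasiSplit (↥(maximalRealSubfield L)) L (IsCMField.complexConj L) 2).Adelic) :=
    isCompact_iff_compactSpace.1 isCompact_comap_adelicVal_standardMaximalCompactGL
  haveI : IsFiniteMeasure μK := CompactSpace.isFiniteMeasure
  have hφ0 : φ ≠ 0 := fun h => hφ1 (by rw [h, Pi.zero_apply])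
  have hφKm : MemLp (fun k : ↥((standardMaximalCompactGL 2 L).comap (adelicVal (↥(maximalRealSubfield L)) L (IsCMField.complexConj L) 2 ((StdForm.antidiagonal 2).over L)) : Subgroup (quasiSplit (↥(maximalRealSubfield L)) L (IsCMField.complexConj L) 2).Adelic) => φ (k : (quasiSplit (↥(maximalRealSubfield L)) L (IsCMField.complexConj L) 2).Adelic)) 2 μK :=
    MemLp.of_bound (hφc.comp continuous_subtype_val).aestronglyMeasurable Mφ (Eventually.of_forall fun k => hφM _)
  have hφK : (((hφKm.toLp _ : Lp ℂ 2 μK)) : _ → ℂ) =ᵐ[μK] fun k => φ (k : (quasiSplit (↥(maximalRealSubfield L)) L (IsCMField.complexConj L) 2).Adelic) := MemLp.coeFn_toLp _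
  have hφK0 : (hφKm.toLp _ : Lp ℂ 2 μK) ≠ 0 := ne_zero_of_coeFn_ae_eq L μK hφV hφ0 _ hφK
  have hbKli : LinearIndependent ℂ (fun _ : Unit => (hφKm.toLp _ : Lp ℂ 2 μK)) := linearIndependent_unique_iff.2 hφK0
  -- ★ the B2 consumer
  exact chi_scattering_hs_of_model_m1_cm_two L μ νG μK νI h𝓕I ν h𝓕N h𝓕1 h𝓕c hβ hχ hρ hsd hφc (isChiSection_of_mem hφV) hφM (fun _ : Unit => φ) hqφ hqNF hE1 hqcq
    hPc hPcd hqa (hφKm.toLp _) hφK hφK0 (fun _ : Unit => (hφKm.toLp _ : Lp ℂ 2 μK)) (fun _ => hφK) hbKli (idelicBracket_pos νI h𝓕I) U hUo hUcod T₀ hT₀ Fam hFd hFam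
    (fun n z' hz' => hdec (T₀ n) (hT₀ n) z' hz') hPre hFE' hconj' hσ₀ default

/-! ## §2 The letter-free M1 print: ★ §3's package with the (d)-bill appended -/

/-- **THE (d)-REALNESS ROAD AT M1 — LETTER-FREE UP TO `hdec` AND THE SCALAR (FE).**  For `χ` self-dual unitary trivial on `ℝ_{>0}` and `φ ∈ V(χ, K_max, 1)` continuous bounded with
`φ ∘ ι_∞ = φ(1)`, `φ(1) ≠ 0` real: the ∃-package of ★ `exists_scattering_scalar_package_selfDual_m1_cm_two` VERBATIM (singleton basis `{φ}`, `q`, `Ec`, the scalar `qc`, ONE pole set `P`,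
(E1)–(E4), the Maass–Selberg families, the tube formula) **and**, for every `σ₀ > 1`, given the scalar (FE) off `P`: `hreal` and the entry letter `hs` for `s := qc default` — under the
ONE outer socket `hdec`. [cite: MoeglinWaldspurger1995, IV.1.10–IV.1.11, IV.3.12 (a)] [cite: Langlands1976, §7] [cite: BernsteinLapid2019, Thm 2.3, §4] -/
theorem chi_scattering_real_poles_m1_letterFree_cm_two
    (μ : Measure (quasiSplit (↥(maximalRealSubfield L)) L (IsCMField.complexConj L) 2).automorphicQuotient) [(quasiSplit (↥(maximalRealSubfield L)) L (IsCMField.complexConj L) 2).IsAutomorphicMeasure μ]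
    (νG : Measure (quasiSplit (↥(maximalRealSubfield L)) L (IsCMField.complexConj L) 2).Adelic) [νG.IsHaarMeasure] [νG.IsInvInvariant] [SFinite νG]
    (μK : Measure ↥((standardMaximalCompactGL 2 L).comap (adelicVal (↥(maximalRealSubfield L)) L (IsCMField.complexConj L) 2 ((StdForm.antidiagonal 2).over L)) : Subgroup (quasiSplit (↥(maximalRealSubfield L)) L (IsCMField.complexConj L) 2).Adelic)) [μK.IsHaarMeasure]
    (νI : Measure (AdeleRing (𝓞 L) L)ˣ) [νI.IsHaarMeasure]
    {𝓕I : Set (AdeleRing (𝓞 L) L)ˣ} (h𝓕I : IsIdeleClassDomain L 𝓕I)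
    (ν : Measure ↥(adelicUnipotent (↥(maximalRealSubfield L)) L (IsCMField.complexConj L) 2)) [ν.IsHaarMeasure] [ν.IsMulRightInvariant] [ν.IsInvInvariant]
    {𝓕 : Set ↥(adelicUnipotent (↥(maximalRealSubfield L)) L (IsCMField.complexConj L) 2)} (h𝓕N : IsFundamentalDomain ↥(rationalUnipotent (↥(maximalRealSubfield L)) L (IsCMField.complexConj L) 2) 𝓕 ν) (h𝓕1 : ν 𝓕 = 1)
    (h𝓕c : IsCompact (closure 𝓕))
    {β : (quasiSplit (↥(maximalRealSubfield L)) L (IsCMField.complexConj L) 2).Adelic → ℝ≥0∞} (hβ : IsCoveringWeight ↥((arithmeticBorel (↥(maximalRealSubfield L)) L (IsCMField.complexConj L) 2).map (quasiSplit (↥(maximalRealSubfield L)) L (IsCMField.complexConj L) 2).arithmeticSubgroup.subtype) β)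
    -- the self-dual unitary character and the NORMALISED non-degenerate M1 section (`φ(1)` real, `≠ 0`)
    {χ : HeckeCharacter L} (hχ : χ.IsUnitary) (hρ : ∀ r : ℝ≥0ˣ, χ (posRealIdele L r) = 1) (hsd : reflectChar (IsCMField.complexConj L) χ = χ)
    {φ : (quasiSplit (↥(maximalRealSubfield L)) L (IsCMField.complexConj L) 2).Adelic → ℂ} (hφV : φ ∈ chiSectionSpace χ ((standardMaximalCompactGL 2 L).comap (adelicVal (↥(maximalRealSubfield L)) L (IsCMField.complexConj L) 2 ((StdForm.antidiagonal 2).over L)) : Subgroup (quasiSplit (↥(maximalRealSubfield L)) L (IsCMField.complexConj L) 2).Adelic) (fun _ => 1)) (hφc : Continuous φ) {Mφ : ℝ} (hφM : ∀ x, ‖φ x‖ ≤ Mφ)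
    (hφ1 : φ 1 ≠ 0) (hφ1r : conj (φ 1) = φ 1)
    (hφinf : ∀ a : arch (↥(maximalRealSubfield L)) L (IsCMField.complexConj L) 2 ((StdForm.antidiagonal 2).over L), φ (archToAdelic (↥(maximalRealSubfield L)) L (IsCMField.complexConj L) 2 _ a) = φ 1)
    {μZ : Measure (borelQuotient (↥(maximalRealSubfield L)) L (IsCMField.complexConj L) 2)} [SFinite μZ]
    (hμZ : ∀ f : borelQuotient (↥(maximalRealSubfield L)) L (IsCMField.complexConj L) 2 → ℝ≥0∞, Measurable f → ∫⁻ z, f z ∂μZ = ∫⁻ g, β g * f (toBorelQuotient (↥(maximalRealSubfield L)) L (IsCMField.complexConj L) 2 g) ∂νG)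
    (hdec : ∀ T : ℝ≥0, 1 ≤ T → ∀ z' : ℂ, 1 < z'.re → ∃ M₁ : ℝ, ∀ g : (quasiSplit (↥(maximalRealSubfield L)) L (IsCMField.complexConj L) 2).Adelic, T < borelHeight g →
      ‖eisensteinSeriesU (flatSectionU φ z') g - borelConstantTerm ν 𝓕 (eisensteinSeriesU (flatSectionU φ z')) g‖ ≤ M₁) :
    ∃ (bV : Module.Basis Unit ℂ ↥(chiSectionSpace (reflectChar (IsCMField.complexConj L) χ) ((standardMaximalCompactGL 2 L).comap (adelicVal (↥(maximalRealSubfield L)) L (IsCMField.complexConj L) 2 ((StdForm.antidiagonal 2).over L)) : Subgroup (quasiSplit (↥(maximalRealSubfield L)) L (IsCMField.complexConj L) 2).Adelic) (fun _ => 1))) (q : Unit → ℂ → ℂ) (Ec : ℂ → (quasiSplit (↥(maximalRealSubfield L)) L (IsCMField.complexConj L) 2).Adelic → ℂ) (qc : Unit → ℂ → ℂ) (P : Set ℂ),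
      (∀ j, ((bV j : ↥(chiSectionSpace (reflectChar (IsCMField.complexConj L) χ) ((standardMaximalCompactGL 2 L).comap (adelicVal (↥(maximalRealSubfield L)) L (IsCMField.complexConj L) 2 ((StdForm.antidiagonal 2).over L)) : Subgroup (quasiSplit (↥(maximalRealSubfield L)) L (IsCMField.complexConj L) 2).Adelic) (fun _ => 1))) : (quasiSplit (↥(maximalRealSubfield L)) L (IsCMField.complexConj L) 2).Adelic → ℂ) = φ) ∧
      ((∀ j, DifferentiableOn ℂ (q j) {z : ℂ | 1 < z.re}) ∧
      (∀ z : ℂ, 1 < z.re → (∑ j, q j z • ((bV j : ↥(chiSectionSpace (reflectChar (IsCMField.complexConj L) χ) ((standardMaximalCompactGL 2 L).comap (adelicVal (↥(maximalRealSubfield L)) L (IsCMField.complexConj L) 2 ((StdForm.antidiagonal 2).over L)) : Subgroup (quasiSplit (↥(maximalRealSubfield L)) L (IsCMField.complexConj L) 2).Adelic) (fun _ => 1))) : (quasiSplit (↥(maximalRealSubfield L)) L (IsCMField.complexConj L) 2).Adelic → ℂ)) = ((((ν 𝓕).toReal⁻¹ : ℝ)) : ℂ) • (fun g : (quasiSplit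 (↥(maximalRealSubfield L)) L (IsCMField.complexConj L) 2).Adelic => (∫ v : ↥(adelicUnipotent (↥(maximalRealSubfield L)) L (IsCMField.complexConj L) 2), flatSectionU φ z ((quasiSplit (↥(maximalRealSubfield L)) L (IsCMField.complexConj L) 2).toAdelic (weylLongU ((IsCMField.complexConj L : L ≃ₐ[↥(maximalRealSubfield L)] L) : L →+* L) (rfl : (StdForm.antidiagonal 2).over L = (StdForm.antidiagonal 2).over L)) * ((v : (quasiSplit (↥(maximalRealSubfield L)) L (IsCMField.complexConj L) 2).Adelic) * g)) ∂ν) * (((borelHeight g : ℝ) : ℂ) ^ (z - 1)))) ∧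
      (∀ g, MeromorphicNFOn (fun z => Ec z g) univ) ∧ (∀ j, MeromorphicNFOn (qc j) univ) ∧
      (∀ z : ℂ, 1 < z.re → Ec z = eisensteinSeriesU (flatSectionU φ z)) ∧ (∀ j (z : ℂ), 1 < z.re → qc j z = q j z) ∧
      IsClosed P ∧ (∀ z₀ : ℂ, ∀ᶠ s in 𝓝[≠] z₀, s ∉ P) ∧ (∀ z ∈ P, z.re ≤ 1) ∧
      (∀ g (z : ℂ), z ∉ P → AnalyticAt ℂ (fun z => Ec z g) z) ∧ (∀ j (z : ℂ), z ∉ P → AnalyticAt ℂ (qc j) z) ∧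
      (∀ g, DifferentiableOn ℂ (fun z => Ec z g) Pᶜ) ∧ (∀ j, DifferentiableOn ℂ (qc j) Pᶜ) ∧
      (∀ z : ℂ, z ∉ P → Continuous (Ec z)) ∧
      ∀ n : ℕ, ∃ U : Set ℂ, IsOpen U ∧ U ⊆ Metric.ball (0 : ℂ) (n + 2) ∧ (∀ z₀ ∈ Metric.ball (0 : ℂ) (n + 2), ∀ᶠ s in 𝓝[≠] z₀, s ∈ U) ∧
        ∃ T₀ : ℝ≥0, 1 ≤ T₀ ∧ ∃ Fam : ℂ → Lp ℂ 2 μ, DifferentiableOn ℂ Fam (U \ P) ∧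
          ∀ z ∈ U \ P, ((Fam z : Lp ℂ 2 μ) : (quasiSplit (↥(maximalRealSubfield L)) L (IsCMField.complexConj L) 2).automorphicQuotient → ℂ) =ᵐ[μ]
            (quasiSplit (↥(maximalRealSubfield L)) L (IsCMField.complexConj L) 2).quotFun (truncation ν 𝓕 T₀ (Ec z))) ∧
      (∀ z : ℂ, 1 < z.re → qc default z = (((ν 𝓕).toReal⁻¹ : ℝ) : ℂ) * ((φ 1)⁻¹ * ∫ v : ↥(adelicUnipotent (↥(maximalRealSubfield L)) L (IsCMField.complexConj L) 2), flatSectionU φ z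
        ((quasiSplit (↥(maximalRealSubfield L)) L (IsCMField.complexConj L) 2).toAdelic (weylLongU (IsCMField.complexConj L : L →+* L)
          (rfl : (StdForm.antidiagonal 2).over L = (StdForm.antidiagonal 2).over L)) * ((v : (quasiSplit (↥(maximalRealSubfield L)) L (IsCMField.complexConj L) 2).Adelic) * 1)) ∂ν)) ∧
      ∀ σ₀ : ℝ, 1 < σ₀ → (∀ z : ℂ, z ∉ P → 1 - z ∉ P → qc default z * qc default (1 - z) = 1) →
        (∀ z : ℂ, ¬ AnalyticAt ℂ (qc default) z → 1 / 2 < z.re → z.re ≤ σ₀ → z.im = 0 ∧ z.re < σ₀) ∧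
          ∃ (S : Finset ℝ) (U' : Set ℂ), (∀ x ∈ S, ¬ AnalyticAt ℂ (qc default) (x : ℂ) ∧ 1 / 2 < x ∧ x < σ₀) ∧ IsOpen U' ∧ {z : ℂ | 1 / 2 ≤ z.re ∧ z.re ≤ σ₀} ⊆ U' ∧
            DifferentiableOn ℂ (qc default) (U' \ ((S.image fun x : ℝ => (x : ℂ)) : Set ℂ)) := by
  classical
  obtain ⟨bV, q, Ec, qc, P, hbV, ⟨hq, hqφ, hEcNF, hqNF, hE1, hqcq, hPc, hPcd, hPre, hEan, hqa, hEdiff, hqdiff, hEcont, hF⟩, htube⟩ :=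
    exists_scattering_scalar_package_selfDual_m1_cm_two L μ νG ν h𝓕N h𝓕c (by rw [h𝓕1]; exact one_ne_zero) hβ hμZ hφV hφc hφM hφinf hsd hφ1
  refine ⟨bV, q, Ec, qc, P, hbV, ⟨hq, hqφ, hEcNF, hqNF, hE1, hqcq, hPc, hPcd, hPre, hEan, hqa, hEdiff, hqdiff, hEcont, hF⟩, htube, ?_⟩
  intro σ₀ hσ₀ hFE
  choose U hUo hUD hUcd T₀ hT₀ Fam hFd hFam using hF
  have hqφ' : ∀ z : ℂ, 1 < z.re → (∑ j, q j z • φ) = ((((ν 𝓕).toReal⁻¹ : ℝ)) : ℂ) • (fun g : (quasiSplit (↥(maximalRealSubfield L)) L (IsCMField.complexConj L) 2).Adelic => (∫ v : ↥(adelicUnipotent (↥(maximalRealSubfield L)) L (IsCMField.complexConj L) 2), flatSectionU φ z ((quasiSplit (↥(maximalRealSubfield L)) L (IsCMField.complexConj L) 2).toAdelic (weylLongU ((IsCMField.complexConj L : L ≃ₐ[↥(maximalRealSubfield L)] L) : L →+* L) (rfl : (StdForm.antidiagonal 2).over L = (StdForm.antidiagonal 2).over L)) * ((v : (quasiSplit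 (↥(maximalRealSubfield L)) L (IsCMField.complexConj L) 2).Adelic) * g)) ∂ν) * (((borelHeight g : ℝ) : ℂ) ^ (z - 1))) := fun z hz => by
    rw [← hqφ z hz]
    exact Finset.sum_congr rfl fun j _ => by rw [hbV j]
  exact chi_scattering_hs_of_scalarPackage_m1_cm_two L μ νG μK νI h𝓕I ν h𝓕N h𝓕1 h𝓕c hβ hχ hρ hsd hφV hφc hφM hφ1 hφ1r hqφ' hqNF hE1 hqcq hPc hPcd hPre hqa
    U hUo hUcd T₀ hT₀ Fam hFd hFam htube hdec hFE hσ₀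

end Summit.HodgeConjecture.HodgeConjecture.Cruxes.H413.K2E1ChiScatteringRealPolesM1CMTwoLetterFree

end
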